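/-
Copyright (c) 2026 the pub-hodgecm-mathlib formalisation cell (harness21).  Track B «K2-LIT» prover seat hodgecm-mathlib-K2E3-p03 (g3) (road (d-w) owner), 2026-09-04:
‹S› ROAD J, letter ‹J3› v2, THE (d-w)-CLASS LEAF PAYER — the (J3d-w) socket modulo the ONE closed letter (W3) «wild plane mass identity».
-/
import Summits.HodgeConjecture.HodgeConjecture.Theorems.K2E3CompatibleMeasureEPIdentityRankOneWildEngine   -- ★ (this seat): §2 `compatibleMeasureEPIdentityRankOne_of_ramified_of_wildPlaneMass` (the (d-w) engine from (W3)_v)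
import HarnessLib

/-!
# ‹J3› (d-w): the (J3d-w) leaf `sig_K2E3CompatibleMeasureEPIdentityRankOneDyadicRamified` MODULO ONE NAMED LETTER (W3) «wild plane mass identity»
# (Rogawski 1990 §8.1 pp. 116–117; Kottwitz 1988 §1 Thm. 1, §2 Thm. 2)

Cell `pub/hodgecm-mathlib`, crux H413 = `stmt-HodgeConjecture-24833` (supports-only, `--as helper`), Track B, ROAD J, letter ‹J3› v2, residue leaf **(J3d-w)**
`U3bCentralGermsLeaves.sig_K2E3CompatibleMeasureEPIdentityRankOneDyadicRamified` (PART C :333; guards `(2 : 𝓞 L⁺) ∈ v.asIdeal → ¬ Algebra.IsUnramifiedIn (𝓞 L) v.asIdeal →`), payer road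
**(d-w)** (owner: this seat; dealer K2E3-plan (g2) RULING (R-dw) 02:41Z «W4 GREEN MODULO EXACTLY ONE NAMED LETTER (W3)»).  THIS FILE = W4:
**`compatibleMeasureEPIdentityRankOne_dyadicRamified_of_wildPlaneMass (hW3 : ‹W3›) : ‹(J3d-w) bytes VERBATIM›`** = the engine ★ `…WildEngine.compatibleMeasureEPIdentityRankOne_of_ramified_of_wildPlaneMass`
(§2 of the sister file: S1 ★ W2 (E-w) by type, S3 ★ W1 + ★ `exists_blockModel_dock_of_not_norm` + ★ (D-b), S4 ★ W1 §3 + anisotropy ⇒ compactness + ★ R3d + `U(1)` divides out, S5)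
fed with the closed letter **(W3) «WILD PLANE MASS IDENTITY»** (the `hW3` binder below — its text IS the cand socket `K2/K2E3-p03/g3/sig_K2E3WildPlaneMassIdentity.cand.v1.K2E3-p03-g3.lean`
token for token): at a dyadic ramified `w ∣ v`, for every global `ξ ∈ L⁺` which is a `w`-unit and NOT a norm from `L_w`, and the anti-fixed `α ∈ L_wˣ`,
`κ(α) · t^ω_{⟨1,−ξ⟩,v}(1)(U(⟨1,−ξ⟩)_v) = ρ_{Φ₂,v}(1)` with `κ = (q−1)∕(q+1)` if `|α|_w = |ϖ_w|` (√π), `κ = (q−1)∕2` if `|α|_w = 1` (√u) — Kottwitz's «`e(G)·μ_EP` is compatible across inner forms»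
[Kottwitz1988 §1 Thm. 1, §2 Thm. 2] for `U(1,1) ∕ U(2)_an` over `L_w ∕ L⁺_v`, i.e. `d(St_{U(1,1)})·vol(U(2)_an) = 1` [Rogawski1990 (8.1.1)–(8.1.2)], in ★ D1's currency at a WILD place.
TIE (home probe `K2/K2E3-p03/g3/ProbeTie_J3dw.K2E3-p03-g3.lean`, farm rc 0, TRIO): `tie (hW3 : ‹cand bytes›) : type_of% @U3bCentralGerms.sig_K2E3CompatibleMeasureEPIdentityRankOneDyadicRamified := …_of_wildPlaneMass hW3`.
(W3) is NOT in print for `m = ord_v 2 > 1` ([Cho2016 Thm. 22; Cho2018]: `m = 1`); its in-house road (CENSUS-J3dw §2 (K)): ★ radius engine + Lie-side equalities (L) ⇒ residual-count ratio.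
HONEST LABEL: count-neutral helper; HC_CM is proved only modulo the 7 printed citations (2 remaining named inputs: hLiu418 = `stmt-HodgeConjecture-24832`, h413 = `stmt-HodgeConjecture-24833`)
until rung 0 closes; **(J3d-w) is proved here ONLY MODULO (W3)**, which stays OPEN (a `conditional-result`; the dealer hosts (W3) and re-ties (J3d-w) over it).

## References
* [Kottwitz1988] R. E. Kottwitz, *Tamagawa numbers*, Ann. of Math. 127 (1988), §1 Thm. 1, §2 Thm. 2.
* [Rogawski1990] J. D. Rogawski, *Automorphic Representations of Unitary Groups in Three Variables*, Ann. of Math. Stud. 123 (1990), §8.1 pp. 116–117, §8.2 Prop. 8.2.1 p. 117, §12.6 p. 174, §1.7 p. 6.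
* [Weil1982] A. Weil, *Adeles and Algebraic Groups*, Progress in Math. 23 (1982), Ch. II §2.2, Thm. 2.2.5.
* [Jacobowitz1962] R. Jacobowitz, *Hermitian forms over local fields*, Amer. J. Math. 84 (1962), §5, §§9–11.
-/

set_option autoImplicit false
set_option linter.dupNamespace false

noncomputable section

open NumberField IsDedekindDomain MeasureTheory MeasureTheory.Measure Topology
open Literature.MeasureTheory.Group Literature.NumberTheory.Automorphic Literature.NumberTheory.Automorphic.UnitaryGroup Literature.NumberTheory.Rogawski1990
open Literature.NumberTheory.Weil1982.UnitaryFinTopForm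
open scoped MatrixGroups Matrix NNReal ENNReal

namespace Summit.HodgeConjecture.HodgeConjecture.Cruxes.H413.K2E3CompatibleMeasureEPIdentityRankOneDyadicRamified

open Summit.HodgeConjecture.HodgeConjecture.Cruxes.H413
open Summit.HodgeConjecture.HodgeConjecture.Cruxes.H413.K2E3CompatibleMeasureEPIdentityRankOneWildEngine

/-! ## §3 The (J3d-w) leaf modulo the closed letter (W3) -/

open Set Matrix Literature.NumberTheory.Automorphic.UnitaryGroup Literature.NumberTheory.GaloisRepresentations in
open scoped NNReal Classical in
/-- **§3 THE (J3d-w) LEAF PAYER MODULO (W3).**  `hW3 : ‹(W3) «WILD PLANE MASS IDENTITY»›` (closed statement, see the module docstring; to be hosted as the (d-w) road's residual socket)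
⊢ the (J3d-w) socket `U3bCentralGermsLeaves.sig_K2E3CompatibleMeasureEPIdentityRankOneDyadicRamified` (PART C :333) BYTES VERBATIM — a `conditional-result` until (W3) is ★.
[cite: Kottwitz1988, §1 Thm. 1, §2 Thm. 2] [cite: Rogawski1990, §8.1 pp. 116–117; §12.6 p. 174] -/
theorem compatibleMeasureEPIdentityRankOne_dyadicRamified_of_wildPlaneMass
    (hW3 :
    ∀ (L : Type) [Field L] [NumberField L] [IsCMField L] (v : HeightOneSpectrum (𝓞 ↥(maximalRealSubfield L)))
      (w : UnitaryGroup.PlacesOver L v) (hw : IsCMField.complexConj L • w.1 = w.1),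
      (2 : 𝓞 ↥(maximalRealSubfield L)) ∈ v.asIdeal → ¬ Algebra.IsUnramifiedIn (𝓞 L) v.asIdeal →
      ∀ (ξ : L), IsCMField.complexConj L ξ = ξ → Valued.v (algebraMap L (w.1.adicCompletion L) ξ) = 1 →
      (¬ ∃ t : w.1.adicCompletion L, t * galAdicCompletionMap (L := L) (IsCMField.complexConj L) hw t = algebraMap L (w.1.adicCompletion L) ξ) →
      ∀ [_iA : MeasurableSpace ((UnitaryGroup.cmDatum L 2 !![(1 : L), 0; 0, -ξ]).Local v)] [_bA : BorelSpace ((UnitaryGroup.cmDatum L 2 !![(1 : L), 0; 0, -ξ]).Local v)],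
      ∀ (α : (w.1.adicCompletion L)ˣ), galAdicCompletionMap (L := L) (IsCMField.complexConj L) hw (α : w.1.adicCompletion L) = -(α : w.1.adicCompletion L) →
      (Valued.v (α : w.1.adicCompletion L) = WithZero.exp (-1 : ℤ) →
        (((Nat.card (𝓞 ↥(maximalRealSubfield L) ⧸ v.asIdeal) : ℝ) - 1) / ((Nat.card (𝓞 ↥(maximalRealSubfield L) ⧸ v.asIdeal) : ℝ) + 1)) *
          (Literature.NumberTheory.Weil1982.UnitaryFinTopForm.finTamagawaPartner L 2 !![(1 : L), 0; 0, -ξ] v 1 Set.univ).toReal =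
        ((Literature.NumberTheory.Weil1982.UnitaryFinTopForm.tamagawaDensity L 2 (Matrix.of fun i j : Fin 2 => if i.val + j.val + 1 = 2 then (1 : L) else 0) v 1 : ℝ≥0) : ℝ)) ∧
      (Valued.v (α : w.1.adicCompletion L) = 1 →
        (((Nat.card (𝓞 ↥(maximalRealSubfield L) ⧸ v.asIdeal) : ℝ) - 1) / 2) *
          (Literature.NumberTheory.Weil1982.UnitaryFinTopForm.finTamagawaPartner L 2 !![(1 : L), 0; 0, -ξ] v 1 Set.univ).toReal =
        ((Literature.NumberTheory.Weil1982.UnitaryFinTopForm.tamagawaDensity L 2 (Matrix.of fun i j : Fin 2 => if i.val + j.val + 1 = 2 then (1 : L) else 0) v 1 : ℝ≥0) : ℝ))) :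



    ∀ (L : Type) [Field L] [NumberField L] [IsCMField L] (H' : Matrix (Fin 3) (Fin 3) L) (μ : HeckeCharacter L)
      [∀ v : HeightOneSpectrum (𝓞 ↥(maximalRealSubfield L)),
        MeasurableSpace ((UnitaryGroup.cmDatum L 2 (Matrix.of fun i j : Fin 2 => if i.val + j.val + 1 = 2 then (1 : L) else 0)).Local v ×
          (UnitaryGroup.cmDatum L 1 (Matrix.of fun i j : Fin 1 => if i.val + j.val + 1 = 1 then (1 : L) else 0)).Local v)]
      [∀ v : HeightOneSpectrum (𝓞 ↥(maximalRealSubfield L)),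
        BorelSpace ((UnitaryGroup.cmDatum L 2 (Matrix.of fun i j : Fin 2 => if i.val + j.val + 1 = 2 then (1 : L) else 0)).Local v ×
          (UnitaryGroup.cmDatum L 1 (Matrix.of fun i j : Fin 1 => if i.val + j.val + 1 = 1 then (1 : L) else 0)).Local v)]
      [∀ v : HeightOneSpectrum (𝓞 ↥(maximalRealSubfield L)), MeasurableSpace ((UnitaryGroup.cmDatum L 3 H').Local v)]
      [∀ v : HeightOneSpectrum (𝓞 ↥(maximalRealSubfield L)), BorelSpace ((UnitaryGroup.cmDatum L 3 H').Local v)]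
      (νH : ∀ v : HeightOneSpectrum (𝓞 ↥(maximalRealSubfield L)),
        Measure ((UnitaryGroup.cmDatum L 2 (Matrix.of fun i j : Fin 2 => if i.val + j.val + 1 = 2 then (1 : L) else 0)).Local v ×
          (UnitaryGroup.cmDatum L 1 (Matrix.of fun i j : Fin 1 => if i.val + j.val + 1 = 1 then (1 : L) else 0)).Local v))
      (νG : ∀ v : HeightOneSpectrum (𝓞 ↥(maximalRealSubfield L)), Measure ((UnitaryGroup.cmDatum L 3 H').Local v))
      [∀ v, (νH v).IsHaarMeasure] [∀ v, (νH v).IsMulRightInvariant] [∀ v, (νG v).IsHaarMeasure] [∀ v, (νG v).IsMulRightInvariant],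
      μ.IsUnitary →
      (∀ x : ideleGroup ↥(maximalRealSubfield L), μ (AdeleRing.ideleBaseChange (↥(maximalRealSubfield L)) L x) = quadraticHeckeCharCM L x) →
      (H'.map (cmConjRingHom L)).transpose = H' →
      (∀ x : Fin 3 → L, Literature.AlgebraicGeometry.ShimuraVarieties.hermForm (cmConjRingHom L) H' x x = 0 → x = 0) →
      ∀ (v : HeightOneSpectrum (𝓞 ↥(maximalRealSubfield L))), Subsingleton (UnitaryGroup.PlacesOver L v) →
      -- (J3d-w) residue-class guards: `v` DYADIC (`2 ∈ v`) and RAMIFIED in `L ∕ L⁺` (wildly ramified quadratic datum)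
      (2 : 𝓞 ↥(maximalRealSubfield L)) ∈ v.asIdeal → ¬ Algebra.IsUnramifiedIn (𝓞 L) v.asIdeal →
      ∀ [_iH : ∀ a : ((UnitaryGroup.cmDatum L 2 (Matrix.of fun i j : Fin 2 => if i.val + j.val + 1 = 2 then (1 : L) else 0)).Local v × (UnitaryGroup.cmDatum L 1 (Matrix.of fun i j : Fin 1 => if i.val + j.val + 1 = 1 then (1 : L) else 0)).Local v),
          MeasurableSpace (((UnitaryGroup.cmDatum L 2 (Matrix.of fun i j : Fin 2 => if i.val + j.val + 1 = 2 then (1 : L) else 0)).Local v × (UnitaryGroup.cmDatum L 1 (Matrix.of fun i j : Fin 1 => if i.val + j.val + 1 = 1 then (1 : L) else 0)).Local v) ⧸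
            Subgroup.centralizer ({a} : Set ((UnitaryGroup.cmDatum L 2 (Matrix.of fun i j : Fin 2 => if i.val + j.val + 1 = 2 then (1 : L) else 0)).Local v × (UnitaryGroup.cmDatum L 1 (Matrix.of fun i j : Fin 1 => if i.val + j.val + 1 = 1 then (1 : L) else 0)).Local v)))]
        [_bH : ∀ a : ((UnitaryGroup.cmDatum L 2 (Matrix.of fun i j : Fin 2 => if i.val + j.val + 1 = 2 then (1 : L) else 0)).Local v × (UnitaryGroup.cmDatum L 1 (Matrix.of fun i j : Fin 1 => if i.val + j.val + 1 = 1 then (1 : L) else 0)).Local v),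
          BorelSpace (((UnitaryGroup.cmDatum L 2 (Matrix.of fun i j : Fin 2 => if i.val + j.val + 1 = 2 then (1 : L) else 0)).Local v × (UnitaryGroup.cmDatum L 1 (Matrix.of fun i j : Fin 1 => if i.val + j.val + 1 = 1 then (1 : L) else 0)).Local v) ⧸
            Subgroup.centralizer ({a} : Set ((UnitaryGroup.cmDatum L 2 (Matrix.of fun i j : Fin 2 => if i.val + j.val + 1 = 2 then (1 : L) else 0)).Local v × (UnitaryGroup.cmDatum L 1 (Matrix.of fun i j : Fin 1 => if i.val + j.val + 1 = 1 then (1 : L) else 0)).Local v)))]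
        [_iG : ∀ γ : ((UnitaryGroup.cmDatum L 3 H').Local v), MeasurableSpace (((UnitaryGroup.cmDatum L 3 H').Local v) ⧸ Subgroup.centralizer ({γ} : Set ((UnitaryGroup.cmDatum L 3 H').Local v)))]
        [_bG : ∀ γ : ((UnitaryGroup.cmDatum L 3 H').Local v), BorelSpace (((UnitaryGroup.cmDatum L 3 H').Local v) ⧸ Subgroup.centralizer ({γ} : Set ((UnitaryGroup.cmDatum L 3 H').Local v)))]
        (mH : OrbitalMeasureFamily ((UnitaryGroup.cmDatum L 2 (Matrix.of fun i j : Fin 2 => if i.val + j.val + 1 = 2 then (1 : L) else 0)).Local v × (UnitaryGroup.cmDatum L 1 (Matrix.of fun i j : Fin 1 => if i.val + j.val + 1 = 1 then (1 : L) else 0)).Local v))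
        (mG : OrbitalMeasureFamily ((UnitaryGroup.cmDatum L 3 H').Local v)),
      mH.IsCanonical (IsLocalGRegular L v) (νH v) → mG.IsCanonical (fun γ => IsRegularElt (γ.val : GL (Fin 3) (UnitaryGroup.LocalRing L v))) (νG v) →
      ∀ (εH : ((UnitaryGroup.cmDatum L 2 (Matrix.of fun i j : Fin 2 => if i.val + j.val + 1 = 2 then (1 : L) else 0)).Local v × (UnitaryGroup.cmDatum L 1 (Matrix.of fun i j : Fin 1 => if i.val + j.val + 1 = 1 then (1 : L) else 0)).Local v)) (a : (UnitaryGroup.LocalRing L v)),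
        (εH.1.val.val : Matrix (Fin 2) (Fin 2) (UnitaryGroup.LocalRing L v)) = a • (1 : Matrix (Fin 2) (Fin 2) (UnitaryGroup.LocalRing L v)) →
        (εH.2.val.val : Matrix (Fin 1) (Fin 1) (UnitaryGroup.LocalRing L v)) 0 0 ≠ a →
        -- the central dock (★ `exists_centralDock_of_fst_eq_smul_one`)
        ∀ (ε : ((UnitaryGroup.cmDatum L 3 H').Local v)) (y : GL (Fin 3) (UnitaryGroup.LocalRing L v)) (θ : ((UnitaryGroup.cmDatum L 2 (Matrix.of fun i j : Fin 2 => if i.val + j.val + 1 = 2 then (1 : L) else 0)).Local v × (UnitaryGroup.cmDatum L 1 (Matrix.of fun i j : Fin 1 => if i.val + j.val + 1 = 1 then (1 : L) else 0)).Local v) ≃ₜ* ↥(Subgroup.centralizer ({ε} : Set ((UnitaryGroup.cmDatum L 3 H').Local v)))),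
        (θ εH).1 = ε →
        (∀ z : ((UnitaryGroup.cmDatum L 2 (Matrix.of fun i j : Fin 2 => if i.val + j.val + 1 = 2 then (1 : L) else 0)).Local v × (UnitaryGroup.cmDatum L 1 (Matrix.of fun i j : Fin 1 => if i.val + j.val + 1 = 1 then (1 : L) else 0)).Local v), (((θ z).1).val : GL (Fin 3) (UnitaryGroup.LocalRing L v)) = y * ((endoEmbLocal L v z).val : GL (Fin 3) (UnitaryGroup.LocalRing L v)) * y⁻¹) →
        -- the bad frame on the dock (★ `exists_badFrame_dock`)
        ∀ (W : GL (Fin 3) (UnitaryGroup.LocalRing L v)), W.val = !![(1 : UnitaryGroup.LocalRing L v), 0, 0; 0, 0, 1; 0, 1, 0] →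
        ∀ (G₁ G₁' : Matrix (Fin 2) (Fin 2) (UnitaryGroup.LocalRing L v)) (G₂ G₂' : Matrix (Fin 1) (Fin 1) (UnitaryGroup.LocalRing L v)) (P' : GL (Fin (2 + 1)) (UnitaryGroup.LocalRing L v)),
        twistGram (UnitaryGroup.conjLocal L (IsCMField.complexConj L) v) ((UnitaryGroup.adelicForm L 3 H').map (UnitaryGroup.adeleToLocal L v)) (y * W).val = UnitaryGroup.finSum 2 1 G₁ G₂ →
        twistGram (UnitaryGroup.conjLocal L (IsCMField.complexConj L) v) ((UnitaryGroup.adelicForm L 3 H').map (UnitaryGroup.adeleToLocal L v)) P'.val = UnitaryGroup.finSum 2 1 G₁' G₂' →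
        (¬ ∃ z : UnitaryGroup.LocalRing L v, IsUnit z ∧ G₁'.det = G₁.det * (UnitaryGroup.conjLocal L (IsCMField.complexConj L) v z * z)) →
        -- the orbit of the dock point `ε` is closed (`(ε − a)(ε − u) = 0` with `a − u` a unit: ★ `isClosed_conjClass_local_of_mul_sub_smul_eq_zero`)
        IsClosed {g : ((UnitaryGroup.cmDatum L 3 H').Local v) | ∃ x : ((UnitaryGroup.cmDatum L 3 H').Local v), x * ε * x⁻¹ = g} →
        -- an Euler–Poincaré datum `(ν₂, m₂, f₂, r)` on `U(Φ₂)_v` (★ J2♯ `rankOneEulerPoincareNonsplit_withCentralValue`'s inputs and conclusion fields, BOUND): Borel structures on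
        -- `U(Φ₂)_v` and its orbit spaces, a Haar measure `ν₂ = (pr₁)_* ν_H`, a family `m₂` canonical for the regular classes and `ν₂`, `f₂ ∈ C_c^∞(U(Φ₂)_v)` with orbital integrals
        -- `1 ∕ 0` on the regular elliptic ∕ split classes (w.r.t. `m₂`), and the scalar value `f₂(b·1) = −r`
        ∀ [_iU₂ : MeasurableSpace ((UnitaryGroup.cmDatum L 2 (Matrix.of fun i j : Fin 2 => if i.val + j.val + 1 = 2 then (1 : L) else 0)).Local v)] [_bU₂ : BorelSpace ((UnitaryGroup.cmDatum L 2 (Matrix.of fun i j : Fin 2 => if i.val + j.val + 1 = 2 then (1 : L) else 0)).Local v)]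
          [_iZ₂ : ∀ γ : ((UnitaryGroup.cmDatum L 2 (Matrix.of fun i j : Fin 2 => if i.val + j.val + 1 = 2 then (1 : L) else 0)).Local v), MeasurableSpace (((UnitaryGroup.cmDatum L 2 (Matrix.of fun i j : Fin 2 => if i.val + j.val + 1 = 2 then (1 : L) else 0)).Local v) ⧸ Subgroup.centralizer ({γ} : Set ((UnitaryGroup.cmDatum L 2 (Matrix.of fun i j : Fin 2 => if i.val + j.val + 1 = 2 then (1 : L) else 0)).Local v)))]
          [_bZ₂ : ∀ γ : ((UnitaryGroup.cmDatum L 2 (Matrix.of fun i j : Fin 2 => if i.val + j.val + 1 = 2 then (1 : L) else 0)).Local v), BorelSpace (((UnitaryGroup.cmDatum L 2 (Matrix.of fun i j : Fin 2 => if i.val + j.val + 1 = 2 then (1 : L) else 0)).Local v) ⧸ Subgroup.centralizer ({γ} : Set ((UnitaryGroup.cmDatum L 2 (Matrix.of fun i j : Fin 2 => if i.val + j.val + 1 = 2 then (1 : L) else 0)).Local v)))]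
          (ν₂ : Measure ((UnitaryGroup.cmDatum L 2 (Matrix.of fun i j : Fin 2 => if i.val + j.val + 1 = 2 then (1 : L) else 0)).Local v)) [ν₂.IsHaarMeasure] [ν₂.IsMulRightInvariant]
          (m₂ : OrbitalMeasureFamily ((UnitaryGroup.cmDatum L 2 (Matrix.of fun i j : Fin 2 => if i.val + j.val + 1 = 2 then (1 : L) else 0)).Local v)),
        Measure.map (Prod.fst : (((UnitaryGroup.cmDatum L 2 (Matrix.of fun i j : Fin 2 => if i.val + j.val + 1 = 2 then (1 : L) else 0)).Local v) × ((UnitaryGroup.cmDatum L 1 (Matrix.of fun i j : Fin 1 => if i.val + j.val + 1 = 1 then (1 : L) else 0)).Local v)) → ((UnitaryGroup.cmDatum L 2 (Matrix.of fun i j : Fin 2 => if i.val + j.val + 1 = 2 then (1 : L) else 0)).Local v)) (νH v) = ν₂ →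
        m₂.IsCanonical (fun γ => IsRegularElt (γ.val : GL (Fin 2) (UnitaryGroup.LocalRing L v))) ν₂ →
        -- ‹J3› (∃-form): an Euler–Poincaré datum `(f₂, r)` on `U(Φ₂)_v` for `(ν₂, m₂)` — ★ J2♯'s three conclusion fields — TOGETHER WITH the compatible-measure identity
        ∃ (f₂ : ((UnitaryGroup.cmDatum L 2 (Matrix.of fun i j : Fin 2 => if i.val + j.val + 1 = 2 then (1 : L) else 0)).Local v) → ℂ) (r : ℝ), IsLocSmooth f₂ ∧
        (∀ γ : ((UnitaryGroup.cmDatum L 2 (Matrix.of fun i j : Fin 2 => if i.val + j.val + 1 = 2 then (1 : L) else 0)).Local v), IsRegularElt (γ.val : GL (Fin 2) (UnitaryGroup.LocalRing L v)) → CompactSpace (Subgroup.centralizer ({γ} : Set ((UnitaryGroup.cmDatum L 2 (Matrix.of fun i j : Fin 2 => if i.val + j.val + 1 = 2 then (1 : L) else 0)).Local v))) →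
            classOrbitalIntegral m₂ f₂ (ConjClasses.mk γ) = 1) ∧
        (∀ γ : ((UnitaryGroup.cmDatum L 2 (Matrix.of fun i j : Fin 2 => if i.val + j.val + 1 = 2 then (1 : L) else 0)).Local v), IsRegularElt (γ.val : GL (Fin 2) (UnitaryGroup.LocalRing L v)) → ¬ CompactSpace (Subgroup.centralizer ({γ} : Set ((UnitaryGroup.cmDatum L 2 (Matrix.of fun i j : Fin 2 => if i.val + j.val + 1 = 2 then (1 : L) else 0)).Local v))) →
            classOrbitalIntegral m₂ f₂ (ConjClasses.mk γ) = 0) ∧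
        (∀ (z : ((UnitaryGroup.cmDatum L 2 (Matrix.of fun i j : Fin 2 => if i.val + j.val + 1 = 2 then (1 : L) else 0)).Local v)) (b : UnitaryGroup.LocalRing L v),
            ((z.val : GL (Fin 2) (UnitaryGroup.LocalRing L v)).val : Matrix (Fin 2) (Fin 2) (UnitaryGroup.LocalRing L v)) = b • (1 : Matrix (Fin 2) (Fin 2) (UnitaryGroup.LocalRing L v)) →
            f₂ z = -(r : ℂ)) ∧
          -- the identity: for every framed, matched second class `ε′` ((α)'s outputs) and every Haar comparison scalar `aθ` on `Z(ε)` ((β)'s (b3))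
          ∀ (ε' : ((UnitaryGroup.cmDatum L 3 H').Local v)),
            (ε'.val.val : Matrix (Fin 3) (Fin 3) (UnitaryGroup.LocalRing L v)) * P'.val =
              P'.val * UnitaryGroup.finSum 2 1 (a • (1 : Matrix (Fin 2) (Fin 2) (UnitaryGroup.LocalRing L v))) (εH.2.val.val : Matrix (Fin 1) (Fin 1) (UnitaryGroup.LocalRing L v)) →
            IsLocalNormPair L H' v εH ε' →
          ∀ (aθ : ℝ≥0),
            Measure.map (⇑θ) (νH v) = aθ • Literature.NumberTheory.Weil1982.UnitaryFinTopForm.finTamagawaPartner L 3 H' v ε →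
            r * (aθ : ℝ) * ((Literature.NumberTheory.Weil1982.UnitaryFinTopForm.finTamagawaPartner L 3 H' v ε') Set.univ).toReal = 1  := by
  intro L _ _ _ H' μ _ _ _ _ νH νG _ _ _ _ hμu hμres hherm hanis v hsub h2 hv
  exact compatibleMeasureEPIdentityRankOne_of_ramified_of_wildPlaneMass L H' μ νH νG hμu hμres hherm hanis v hsub h2 hv
    (fun w hw ξ hξc hξ1 hξnn _ _ α hα => hW3 L v w hw h2 hv ξ hξc hξ1 hξnn α hα)

end Summit.HodgeConjecture.HodgeConjecture.Cruxes.H413.K2E3CompatibleMeasureEPIdentityRankOneDyadicRamified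

end
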